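import Summits.AtomisticToContinuum.HydrodynamicLimit.Theorems.TwoClocksEquilibriumFastWindowLDNormalFormClass
import Summits.AtomisticToContinuum.HydrodynamicLimit.Theorems.TwoClocksEquilibriumFastWindowLDWindowExtension

/-!
# Algebra and closure of the eventual window bound
(crux stmt-AtomisticToContinuum-14440 `TwoClocks.EquilibriumFastWindowLD`, line `Sketch`; lead c4)

Helper file (`--supports stmt-AtomisticToContinuum-14440`) for the normal-form equivalence
`crux ⟺ W` (`TwoClocksEquilibriumFastWindowLDNormalFormEquivalence`). The predicate studied is the
crux's window large-deviation bound for a one-body observable `F` on a tilt range `b`, EVENTUALLY IN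
THE WINDOW: `∀ |β| ≤ b ∀ ε ∃ τ₀ ∀ τ ≥ τ₀ ∃ N₀ ∀ N ≥ N₀, M^F_N(β, τ) ≤ e^{ε(N+1)}` (written out; no new
definition), under the global Gibbs law `G_N = localGibbsLaw σ a₀ u₀ θ₀ N Φ_N`. The eventual form is
what lets two observables be combined at a COMMON window:

* `windowGood_const_mul` — scaling `F ↦ cF` divides the range by `c` (`β ↦ cβ`);
* `windowGood_neg` — `F ↦ −F` keeps the range (`β ↦ −β`);
* `windowGood_add` — Hölder in the observable (`stub_holderSplit`, weight `½`): `F + G` on half the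
  range;
* `windowGood_of_approx` — CLOSURE under sup-norm approximation in the encoded class: for a
  Maxwellian-centred bounded continuous `f`, if `f` is approximable by centred `g` whose observable
  `g(1+|v|²)` has the bound on the range `b`, then `f(1+|v|²)` has it on `b/2` — the remainder
  `(f−g)(1+|v|²)` of sup-weighted size `< δ(β,ε)` is priced STATICALLY at every window
  (`stub_oneSiteGauss` at growth `1` applied to `(f−g)(1+|v|²)/δ` at tilt `2βδ`,
  `stub_staticReduction`), then Hölder.

Statics only (invariance of `G_N`, one-site Gaussian bounds); no dynamics.
-/

noncomputable section

open MeasureTheory ProbabilityTheory Real Set Filter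
open scoped ENNReal BigOperators BoundedContinuousFunction

namespace Summit.AtomisticToContinuum.HydrodynamicLimit.Theorems.FastWindowRG

open Literature.Analysis.FluidPDE Literature.MathematicalPhysics.KineticTheory

/-! ### Algebra of the eventual window bound -/

/-- **Scaling.** If the eventual window bound holds for `F` on the tilt range `b`, it holds for
`c F` (`c > 0`) on the range `b / c`. -/
theorem windowGood_const_mul (σ a₀ θ₀ : ℝ) (u₀ : V3)
    (Φ : (N : ℕ) → HardSphereFlow (Torus.geometry (Fin 3)) (hsDiameter σ N) (N + 1))
    {F : T3 × V3 → ℝ} {b c : ℝ} (hc : 0 < c)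
    (h : ∀ β : ℝ, |β| ≤ b → ∀ ε : ℝ, 0 < ε → ∃ τ₀ : ℝ, 0 < τ₀ ∧ ∀ τ : ℝ, τ₀ ≤ τ →
      ∃ N₀ : ℕ, ∀ N : ℕ, N₀ ≤ N →
        ∫⁻ z, ENNReal.ofReal (Real.exp (β * ∑ i : Fin (N + 1),
            (τ * ((N : ℝ) + 1) ^ (-(1 / 3 : ℝ)))⁻¹ *
              ∫ r in (0 : ℝ)..(τ * ((N : ℝ) + 1) ^ (-(1 / 3 : ℝ))), F (((Φ N).flow r z) i)))
          ∂(localGibbsLaw σ (fun _ => a₀) (fun _ => u₀) (fun _ => θ₀) N (Φ N)) ≤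
          ENNReal.ofReal (Real.exp (ε * ((N : ℝ) + 1)))) :
    ∀ β : ℝ, |β| ≤ b / c → ∀ ε : ℝ, 0 < ε → ∃ τ₀ : ℝ, 0 < τ₀ ∧ ∀ τ : ℝ, τ₀ ≤ τ →
      ∃ N₀ : ℕ, ∀ N : ℕ, N₀ ≤ N →
        ∫⁻ z, ENNReal.ofReal (Real.exp (β * ∑ i : Fin (N + 1),
            (τ * ((N : ℝ) + 1) ^ (-(1 / 3 : ℝ)))⁻¹ *
              ∫ r in (0 : ℝ)..(τ * ((N : ℝ) + 1) ^ (-(1 / 3 : ℝ))), c * F (((Φ N).flow r z) i)))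
          ∂(localGibbsLaw σ (fun _ => a₀) (fun _ => u₀) (fun _ => θ₀) N (Φ N)) ≤
          ENNReal.ofReal (Real.exp (ε * ((N : ℝ) + 1))) := by
  intro β hβ ε hε
  have hβ' : |c * β| ≤ b := by
    rw [abs_mul, abs_of_pos hc]
    rwa [le_div_iff₀' hc] at hβ
  obtain ⟨τ₀, hτ₀, H⟩ := h (c * β) hβ' ε hε
  refine ⟨τ₀, hτ₀, fun τ hτ => ?_⟩
  obtain ⟨N₀, hN⟩ := H τ hτ
  refine ⟨N₀, fun N hNN => ?_⟩
  have e : ∀ z : Config (N + 1) (Fin 3) T3, β * ∑ i : Fin (N + 1),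
      (τ * ((N : ℝ) + 1) ^ (-(1 / 3 : ℝ)))⁻¹ *
        ∫ r in (0 : ℝ)..(τ * ((N : ℝ) + 1) ^ (-(1 / 3 : ℝ))), c * F (((Φ N).flow r z) i) =
      c * β * ∑ i : Fin (N + 1), (τ * ((N : ℝ) + 1) ^ (-(1 / 3 : ℝ)))⁻¹ *
        ∫ r in (0 : ℝ)..(τ * ((N : ℝ) + 1) ^ (-(1 / 3 : ℝ))), F (((Φ N).flow r z) i) := by
    intro z
    simp_rw [intervalIntegral.integral_const_mul]
    rw [Finset.mul_sum, Finset.mul_sum]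
    refine Finset.sum_congr rfl fun i _ => ?_
    ring
  simp_rw [e]
  exact hN N hNN

/-- **Symmetry.** If the eventual window bound holds for `F` on the tilt range `b`, it holds for
`−F` on the same range. -/
theorem windowGood_neg : ∀ (σ a₀ θ₀ : ℝ) (u₀ : V3)
    (Φ : (N : ℕ) → HardSphereFlow (Torus.geometry (Fin 3)) (hsDiameter σ N) (N + 1))
    {F : T3 × V3 → ℝ} {b : ℝ},
    (∀ β : ℝ, |β| ≤ b → ∀ ε : ℝ, 0 < ε → ∃ τ₀ : ℝ, 0 < τ₀ ∧ ∀ τ : ℝ, τ₀ ≤ τ →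
      ∃ N₀ : ℕ, ∀ N : ℕ, N₀ ≤ N →
        ∫⁻ z, ENNReal.ofReal (Real.exp (β * ∑ i : Fin (N + 1),
            (τ * ((N : ℝ) + 1) ^ (-(1 / 3 : ℝ)))⁻¹ *
              ∫ r in (0 : ℝ)..(τ * ((N : ℝ) + 1) ^ (-(1 / 3 : ℝ))), F (((Φ N).flow r z) i)))
          ∂(localGibbsLaw σ (fun _ => a₀) (fun _ => u₀) (fun _ => θ₀) N (Φ N)) ≤
          ENNReal.ofReal (Real.exp (ε * ((N : ℝ) + 1)))) →
    ∀ β : ℝ, |β| ≤ b → ∀ ε : ℝ, 0 < ε → ∃ τ₀ : ℝ, 0 < τ₀ ∧ ∀ τ : ℝ, τ₀ ≤ τ →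
      ∃ N₀ : ℕ, ∀ N : ℕ, N₀ ≤ N →
        ∫⁻ z, ENNReal.ofReal (Real.exp (β * ∑ i : Fin (N + 1),
            (τ * ((N : ℝ) + 1) ^ (-(1 / 3 : ℝ)))⁻¹ *
              ∫ r in (0 : ℝ)..(τ * ((N : ℝ) + 1) ^ (-(1 / 3 : ℝ))), -F (((Φ N).flow r z) i)))
          ∂(localGibbsLaw σ (fun _ => a₀) (fun _ => u₀) (fun _ => θ₀) N (Φ N)) ≤
          ENNReal.ofReal (Real.exp (ε * ((N : ℝ) + 1))) := by
  intro σ a₀ θ₀ u₀ Φ F b h β hβ ε hε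
  have hβ' : |-β| ≤ b := by rwa [abs_neg]
  obtain ⟨τ₀, hτ₀, H⟩ := h (-β) hβ' ε hε
  refine ⟨τ₀, hτ₀, fun τ hτ => ?_⟩
  obtain ⟨N₀, hN⟩ := H τ hτ
  refine ⟨N₀, fun N hNN => ?_⟩
  have e : ∀ z : Config (N + 1) (Fin 3) T3, β * ∑ i : Fin (N + 1),
      (τ * ((N : ℝ) + 1) ^ (-(1 / 3 : ℝ)))⁻¹ *
        ∫ r in (0 : ℝ)..(τ * ((N : ℝ) + 1) ^ (-(1 / 3 : ℝ))), -F (((Φ N).flow r z) i) =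
      -β * ∑ i : Fin (N + 1), (τ * ((N : ℝ) + 1) ^ (-(1 / 3 : ℝ)))⁻¹ *
        ∫ r in (0 : ℝ)..(τ * ((N : ℝ) + 1) ^ (-(1 / 3 : ℝ))), F (((Φ N).flow r z) i) := by
    intro z
    simp_rw [intervalIntegral.integral_neg]
    rw [Finset.mul_sum, Finset.mul_sum]
    refine Finset.sum_congr rfl fun i _ => ?_
    ring
  simp_rw [e]
  exact hN N hNN

/-- **Sum (Hölder in the observable).** If the eventual window bound holds for the continuous
`F` and `G` on the tilt range `b`, it holds for `F + G` on the range `b / 2`: at a common good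
window, `M^{F+G}(β) ≤ M^F(2β)^{1/2} M^G(2β)^{1/2}` (`stub_holderSplit`). -/
theorem windowGood_add (σ a₀ θ₀ : ℝ) (u₀ : V3)
    (Φ : (N : ℕ) → HardSphereFlow (Torus.geometry (Fin 3)) (hsDiameter σ N) (N + 1))
    {F G : T3 × V3 → ℝ} (hF : Continuous F) (hG : Continuous G) {b : ℝ}
    (hFb : ∀ β : ℝ, |β| ≤ b → ∀ ε : ℝ, 0 < ε → ∃ τ₀ : ℝ, 0 < τ₀ ∧ ∀ τ : ℝ, τ₀ ≤ τ →
      ∃ N₀ : ℕ, ∀ N : ℕ, N₀ ≤ N →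
        ∫⁻ z, ENNReal.ofReal (Real.exp (β * ∑ i : Fin (N + 1),
            (τ * ((N : ℝ) + 1) ^ (-(1 / 3 : ℝ)))⁻¹ *
              ∫ r in (0 : ℝ)..(τ * ((N : ℝ) + 1) ^ (-(1 / 3 : ℝ))), F (((Φ N).flow r z) i)))
          ∂(localGibbsLaw σ (fun _ => a₀) (fun _ => u₀) (fun _ => θ₀) N (Φ N)) ≤
          ENNReal.ofReal (Real.exp (ε * ((N : ℝ) + 1))))
    (hGb : ∀ β : ℝ, |β| ≤ b → ∀ ε : ℝ, 0 < ε → ∃ τ₀ : ℝ, 0 < τ₀ ∧ ∀ τ : ℝ, τ₀ ≤ τ →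
      ∃ N₀ : ℕ, ∀ N : ℕ, N₀ ≤ N →
        ∫⁻ z, ENNReal.ofReal (Real.exp (β * ∑ i : Fin (N + 1),
            (τ * ((N : ℝ) + 1) ^ (-(1 / 3 : ℝ)))⁻¹ *
              ∫ r in (0 : ℝ)..(τ * ((N : ℝ) + 1) ^ (-(1 / 3 : ℝ))), G (((Φ N).flow r z) i)))
          ∂(localGibbsLaw σ (fun _ => a₀) (fun _ => u₀) (fun _ => θ₀) N (Φ N)) ≤
          ENNReal.ofReal (Real.exp (ε * ((N : ℝ) + 1)))) :
    ∀ β : ℝ, |β| ≤ b / 2 → ∀ ε : ℝ, 0 < ε → ∃ τ₀ : ℝ, 0 < τ₀ ∧ ∀ τ : ℝ, τ₀ ≤ τ →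
      ∃ N₀ : ℕ, ∀ N : ℕ, N₀ ≤ N →
        ∫⁻ z, ENNReal.ofReal (Real.exp (β * ∑ i : Fin (N + 1),
            (τ * ((N : ℝ) + 1) ^ (-(1 / 3 : ℝ)))⁻¹ *
              ∫ r in (0 : ℝ)..(τ * ((N : ℝ) + 1) ^ (-(1 / 3 : ℝ))), (F (((Φ N).flow r z) i) + G (((Φ N).flow r z) i))))
          ∂(localGibbsLaw σ (fun _ => a₀) (fun _ => u₀) (fun _ => θ₀) N (Φ N)) ≤
          ENNReal.ofReal (Real.exp (ε * ((N : ℝ) + 1))) := by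
  intro β hβ ε hε
  have h2β : |2 * β| ≤ b := by
    rw [abs_mul, abs_two]
    linarith
  obtain ⟨τ₁, hτ₁, H₁⟩ := hFb (2 * β) h2β ε hε
  obtain ⟨τ₂, hτ₂, H₂⟩ := hGb (2 * β) h2β ε hε
  refine ⟨max τ₁ τ₂, lt_max_of_lt_left hτ₁, fun τ hτ => ?_⟩
  obtain ⟨N₁, hN₁⟩ := H₁ τ (le_of_max_le_left hτ)
  obtain ⟨N₂, hN₂⟩ := H₂ τ (le_of_max_le_right hτ)
  refine ⟨max N₁ N₂, fun N hNN => ?_⟩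
  have hA := hN₁ N (le_of_max_le_left hNN)
  have hB := hN₂ N (le_of_max_le_right hNN)
  have hτpos : 0 < τ := hτ₁.trans_le (le_of_max_le_left hτ)
  have hw : 0 < τ * ((N : ℝ) + 1) ^ (-(1 / 3 : ℝ)) :=
    mul_pos hτpos (Real.rpow_pos_of_pos (by positivity) _)
  have hsplit := stub_holderSplit σ a₀ θ₀ u₀ N (Φ N) hF hG β (ϑ := 1 / 2) (by norm_num)
    (by norm_num) hw
  refine hsplit.trans ?_
  have eβ1 : β / (1 - 1 / 2) = 2 * β := by ring
  have eβ2 : β / (1 / 2) = 2 * β := by ring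
  rw [eβ1, eβ2]
  refine (mul_le_mul' (rpow_le_ofReal_exp_mul hA (by norm_num))
    (rpow_le_ofReal_exp_mul hB (by norm_num))).trans ?_
  rw [← ENNReal.ofReal_mul (Real.exp_nonneg _), ← Real.exp_add]
  refine ENNReal.ofReal_le_ofReal (Real.exp_le_exp.2 (le_of_eq ?_))
  ring

/-! ### Closure: small admissible perturbations are priced statically -/

/-- **Closure.** Let `f : 𝕋³ × ℝ³ →ᵇ ℝ` be Maxwellian-centred (`∫ f ω M = 0` at every `x`,
`ω = 1 + |v|²`). If `f` is approximable in sup norm by centred `g` for which the eventual window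
bound of `g ω` holds on the tilt range `b`, then the eventual window bound of `f ω` holds on the
range `b / 2`. Given `β, ε`: choose the approximation so fine (`‖g − f‖ < δ(β, ε)`) that the
STATIC bound of the remainder `(f − g) ω` at tilt `2β` is `≤ e^{ε(N+1)/2}` at every window
(`stub_oneSiteGauss` at growth `1` applied to `(f−g)ω/δ` at tilt `2βδ`, `stub_staticReduction`),
and split `f ω = g ω + (f − g) ω` by Hölder (`stub_holderSplit`, weight `½`). -/
theorem windowGood_of_approx {a₀ θ₀ : ℝ} (ha : 0 < a₀) (hθ : 0 < θ₀) (u₀ : V3) {σ : ℝ}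
    (hσ2 : σ ≤ 1 / 2)
    (Φ : (N : ℕ) → HardSphereFlow (Torus.geometry (Fin 3)) (hsDiameter σ N) (N + 1))
    {b : ℝ} (hb : 0 < b) {f : T3 × V3 →ᵇ ℝ}
    (hf0 : ∀ x, ∫ v, f (x, v) * (1 + ‖v‖ ^ 2) * localMaxwellian 1 θ₀ u₀ v = 0)
    (happrox : ∀ δ : ℝ, 0 < δ → ∃ g : T3 × V3 →ᵇ ℝ,
      (∀ x, ∫ v, g (x, v) * (1 + ‖v‖ ^ 2) * localMaxwellian 1 θ₀ u₀ v = 0) ∧ ‖g - f‖ < δ ∧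
      ∀ β : ℝ, |β| ≤ b → ∀ ε : ℝ, 0 < ε → ∃ τ₀ : ℝ, 0 < τ₀ ∧ ∀ τ : ℝ, τ₀ ≤ τ →
        ∃ N₀ : ℕ, ∀ N : ℕ, N₀ ≤ N →
          ∫⁻ z, ENNReal.ofReal (Real.exp (β * ∑ i : Fin (N + 1),
              (τ * ((N : ℝ) + 1) ^ (-(1 / 3 : ℝ)))⁻¹ *
                ∫ r in (0 : ℝ)..(τ * ((N : ℝ) + 1) ^ (-(1 / 3 : ℝ))), g (((Φ N).flow r z) i) * (1 + ‖(((Φ N).flow r z) i).2‖ ^ 2)))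
            ∂(localGibbsLaw σ (fun _ => a₀) (fun _ => u₀) (fun _ => θ₀) N (Φ N)) ≤
            ENNReal.ofReal (Real.exp (ε * ((N : ℝ) + 1)))) :
    ∀ β : ℝ, |β| ≤ b / 2 → ∀ ε : ℝ, 0 < ε → ∃ τ₀ : ℝ, 0 < τ₀ ∧ ∀ τ : ℝ, τ₀ ≤ τ →
      ∃ N₀ : ℕ, ∀ N : ℕ, N₀ ≤ N →
        ∫⁻ z, ENNReal.ofReal (Real.exp (β * ∑ i : Fin (N + 1),
            (τ * ((N : ℝ) + 1) ^ (-(1 / 3 : ℝ)))⁻¹ *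
              ∫ r in (0 : ℝ)..(τ * ((N : ℝ) + 1) ^ (-(1 / 3 : ℝ))), f (((Φ N).flow r z) i) * (1 + ‖(((Φ N).flow r z) i).2‖ ^ 2)))
          ∂(localGibbsLaw σ (fun _ => a₀) (fun _ => u₀) (fun _ => θ₀) N (Φ N)) ≤
          ENNReal.ofReal (Real.exp (ε * ((N : ℝ) + 1))) := by
  have _ := hb
  intro β hβ ε hε
  -- the one-site Gaussian constants at growth `1`
  obtain ⟨t₁, ht₁, K₁, hK₁, hone⟩ := stub_oneSiteGauss hθ u₀ zero_le_one
  -- the approximation radius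
  set δ : ℝ := min 1 (min (t₁ / (2 * |β| + 1)) (ε / (2 * (4 * K₁ * β ^ 2 + 1)))) with hδdef
  have hδ : 0 < δ := lt_min one_pos (lt_min (by positivity) (by positivity))
  have hδ1 : δ ≤ 1 := min_le_left _ _
  have hδt : δ ≤ t₁ / (2 * |β| + 1) := (min_le_right _ _).trans (min_le_left _ _)
  have hδε : δ ≤ ε / (2 * (4 * K₁ * β ^ 2 + 1)) := (min_le_right _ _).trans (min_le_right _ _)
  have ht : |2 * β * δ| ≤ t₁ := by
    rw [abs_mul, abs_mul, abs_two, abs_of_pos hδ]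
    rw [le_div_iff₀ (by positivity)] at hδt
    nlinarith [abs_nonneg β]
  have hKε : K₁ * δ ^ 2 * (2 * β) ^ 2 ≤ ε / 2 := by
    rw [le_div_iff₀ (by positivity)] at hδε
    have hδsq : δ ^ 2 ≤ δ := by nlinarith
    have h4 : 0 ≤ 4 * K₁ * β ^ 2 := by positivity
    nlinarith [mul_le_mul_of_nonneg_left hδsq h4]
  -- the approximation and the remainder `f - g`
  obtain ⟨g, hg0, hgf, hgood⟩ := happrox δ hδ
  have hhn : ‖f - g‖ < δ := by rwa [norm_sub_rev]
  have hh0 : ∀ x, ∫ v, (f - g) (x, v) * (1 + ‖v‖ ^ 2) * localMaxwellian 1 θ₀ u₀ v = 0 := by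
    intro x
    obtain ⟨hF, -, -⟩ := integrable_mul_quadWeight_pairings hθ u₀ f x
    obtain ⟨hG, -, -⟩ := integrable_mul_quadWeight_pairings hθ u₀ g x
    simp_rw [BoundedContinuousFunction.sub_apply, sub_mul]
    rw [integral_sub hF hG, hf0 x, hg0 x, sub_zero]
  -- one-site bound of the remainder at tilt `2β`, constant `K₁ δ²`
  have honeT : ∀ x : T3, ∫⁻ v, ENNReal.ofReal (Real.exp (2 * β * ((f - g) (x, v) * (1 + ‖v‖ ^ 2))))
      ∂(gaussMeasure u₀ θ₀) ≤ ENNReal.ofReal (Real.exp (K₁ * δ ^ 2 * (2 * β) ^ 2)) := by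
    intro x
    have hm1 : Measurable fun v : V3 => (f - g) (x, v) :=
      ((f - g).continuous.comp (Continuous.prodMk_right x)).measurable
    have hm2 : Measurable fun v : V3 => (1 : ℝ) + ‖v‖ ^ 2 := by fun_prop
    have hmeas : Measurable fun v : V3 => (f - g) (x, v) * (1 + ‖v‖ ^ 2) / δ :=
      (hm1.mul hm2).div_const δ
    have hgrowth : ∀ v : V3, |(f - g) (x, v) * (1 + ‖v‖ ^ 2) / δ| ≤ 1 * (1 + ‖v‖ ^ 2) := by
      intro v
      rw [abs_div, abs_of_pos hδ, div_le_iff₀ hδ, one_mul]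
      calc |(f - g) (x, v) * (1 + ‖v‖ ^ 2)| ≤ ‖f - g‖ * (1 + ‖v‖ ^ 2) :=
            abs_mul_quadWeight_le (f - g) (x, v)
        _ ≤ δ * (1 + ‖v‖ ^ 2) := mul_le_mul_of_nonneg_right hhn.le (by positivity)
        _ = (1 + ‖v‖ ^ 2) * δ := mul_comm _ _
    have hcent : ∫ v, (f - g) (x, v) * (1 + ‖v‖ ^ 2) / δ * localMaxwellian 1 θ₀ u₀ v = 0 := by
      have e : (fun v : V3 => (f - g) (x, v) * (1 + ‖v‖ ^ 2) / δ * localMaxwellian 1 θ₀ u₀ v) =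
          fun v => δ⁻¹ * ((f - g) (x, v) * (1 + ‖v‖ ^ 2) * localMaxwellian 1 θ₀ u₀ v) := by
        funext v; ring
      rw [e, integral_const_mul, hh0 x, mul_zero]
    have key := hone _ hmeas hgrowth hcent (2 * β * δ) ht
    have e1 : ∀ v : V3, 2 * β * ((f - g) (x, v) * (1 + ‖v‖ ^ 2)) =
        2 * β * δ * ((f - g) (x, v) * (1 + ‖v‖ ^ 2) / δ) := fun v => by
      field_simp
    have e2 : K₁ * δ ^ 2 * (2 * β) ^ 2 = K₁ * (2 * β * δ) ^ 2 := by ring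
    simp_rw [e1]
    rw [e2]
    exact key
  have hstat : ∀ τ : ℝ, 0 < τ → ∀ N : ℕ,
      ∫⁻ z, ENNReal.ofReal (Real.exp (2 * β * ∑ i : Fin (N + 1),
          (τ * ((N : ℝ) + 1) ^ (-(1 / 3 : ℝ)))⁻¹ *
            ∫ r in (0 : ℝ)..(τ * ((N : ℝ) + 1) ^ (-(1 / 3 : ℝ))),
              (f - g) (((Φ N).flow r z) i) * (1 + ‖(((Φ N).flow r z) i).2‖ ^ 2)))
        ∂(localGibbsLaw σ (fun _ => a₀) (fun _ => u₀) (fun _ => θ₀) N (Φ N)) ≤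
        ENNReal.ofReal (Real.exp (ε / 2 * ((N : ℝ) + 1))) := by
    intro τ hτ N
    have h := stub_staticReduction (F := fun y : T3 × V3 => (f - g) y * (1 + ‖y.2‖ ^ 2)) ha hθ u₀
      hσ2 N (Φ N) (continuous_mul_quadWeight (f - g)) (β := 2 * β) (K := K₁ * δ ^ 2) honeT hτ
    refine h.trans (ENNReal.ofReal_le_ofReal (Real.exp_le_exp.2 ?_))
    exact mul_le_mul_of_nonneg_right hKε (by positivity)
  -- the good window of `g` at tilt `2β`
  have h2β : |2 * β| ≤ b := by
    rw [abs_mul, abs_two]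
    linarith
  obtain ⟨τ₀, hτ₀, H⟩ := hgood (2 * β) h2β ε hε
  refine ⟨τ₀, hτ₀, fun τ hτ => ?_⟩
  obtain ⟨N₀, hN⟩ := H τ hτ
  refine ⟨N₀, fun N hNN => ?_⟩
  have hτpos : 0 < τ := hτ₀.trans_le hτ
  have hw : 0 < τ * ((N : ℝ) + 1) ^ (-(1 / 3 : ℝ)) :=
    mul_pos hτpos (Real.rpow_pos_of_pos (by positivity) _)
  -- split `f ω = g ω + (f - g) ω` and Hölder
  have e : ∀ y : T3 × V3, f y * (1 + ‖y.2‖ ^ 2) =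
      g y * (1 + ‖y.2‖ ^ 2) + (f - g) y * (1 + ‖y.2‖ ^ 2) := fun y => by
    rw [BoundedContinuousFunction.sub_apply]; ring
  simp_rw [e]
  have hsplit := stub_holderSplit σ a₀ θ₀ u₀ N (Φ N) (G := fun y : T3 × V3 => g y * (1 + ‖y.2‖ ^ 2))
    (T := fun y : T3 × V3 => (f - g) y * (1 + ‖y.2‖ ^ 2)) (continuous_mul_quadWeight g)
    (continuous_mul_quadWeight (f - g)) β (ϑ := 1 / 2) (by norm_num) (by norm_num) hw
  refine hsplit.trans ?_
  have eβ1 : β / (1 - 1 / 2) = 2 * β := by ring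
  have eβ2 : β / (1 / 2) = 2 * β := by ring
  rw [eβ1, eβ2]
  refine (mul_le_mul' (rpow_le_ofReal_exp_mul (hN N hNN) (by norm_num))
    (rpow_le_ofReal_exp_mul (hstat τ hτpos N) (by norm_num))).trans ?_
  rw [← ENNReal.ofReal_mul (Real.exp_nonneg _), ← Real.exp_add]
  refine ENNReal.ofReal_le_ofReal (Real.exp_le_exp.2 ?_)
  have hN1 : (0 : ℝ) ≤ (N : ℝ) + 1 := by positivity
  nlinarith [mul_nonneg hε.le hN1]

end Summit.AtomisticToContinuum.HydrodynamicLimit.Theorems.FastWindowRG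

end
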